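import Literature.AlgebraicGeometry.Resolution.HenselizedFunctionFields
import Literature.AlgebraicGeometry.Resolution.GeneralizedStabilityHenselizedRational
import Literature.AlgebraicGeometry.Resolution.HenselizationDefectless
import Literature.AlgebraicGeometry.Resolution.HenselizationHenselian
import HarnessLib

/-!
# Cor. 2.12 from the Lemma of Ostrowski (Kuhlmann 2010, §2.3)

Topic: `Literature/AlgebraicGeometry/Resolution` (valued function fields). F.-V. Kuhlmann,
*Elimination of ramification I: The generalized stability theorem*, Trans. AMS 362 (2010) =
arXiv:1003.5678, §2.3 (p. 7):

> Assume that `(L|K,v)` is a finite extension and the extension of `v` from `K` to `L` is unique.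
> Then the Lemma of Ostrowski says that `[L:K] = (vL:vK)·[Lv:Kv]·p^ν` with `ν ≥ 0` (9) where `p`
> is the characteristic exponent of `Kv` … If `d(L|K,v) = 1`, then we call `(L|K,v)` a defectless
> extension. Note that `(L|K,v)` is always defectless if `char Kv = 0`. Therefore,
> **Corollary 2.12.** Every valued field `(K,v)` with `char Kv = 0` is a defectless field.

("Therefore" passing through Thm. 2.14 / Cor. 2.15: "A valued field `(K,v)` is defectless if and
only if `d(L|K^h,v) = 1` for every finite extension `L|K^h`.") The two statements are the named
facts `Kuhlmann2010OstrowskiLemma` (`GeneralizedStabilityHenselizedRational.lean`) and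
`Kuhlmann2010DefectlessOfResidueCharZero` (`HenselizedFunctionFields.lean`), on which the
value- resp. residue-transcendental cases of (R4) rest; this file PROVES the printed implication
Ostrowski ⇒ Cor. 2.12, so that both cases rest on the Lemma of Ostrowski: extend `v` to the
algebraic closure `Ω = K̃` (Chevalley), pass to the henselization `K^h ⊆ Ω` by **Thm. 2.14**
(PROVED, `Kuhlmann2010DefectlessIffHenselization_holds`), which is henselian (PROVED,
`Kuhlmann2010HenselizationIsHenselian_holds`) and has residue characteristic `0` with `K`; for a
finite `L|K^h` the extension of the valuation is unique, so Ostrowski's lemma with `p = 1` gives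
`[L : K^h] = e·f`, i.e. `K^h` is defectless in `L`.

## Content (PROVED)

* `isDefectlessField_of_isHenselianField_of_ostrowski` — a henselian valued field of residue
  characteristic `0` is a defectless field, from `Kuhlmann2010OstrowskiLemma`.
* `Kuhlmann2010DefectlessOfResidueCharZero.of_ostrowski :
  Kuhlmann2010OstrowskiLemma → Kuhlmann2010DefectlessOfResidueCharZero` — Cor. 2.12.

## Sources

* F.-V. Kuhlmann, Trans. AMS 362 (2010) = arXiv:1003.5678, §2.3: (9), Cor. 2.12, Thm. 2.14,
  Cor. 2.15 (p. 7); §1 ("`g = 1` if `(K,v)` is henselian").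
-/

noncomputable section

open IsLocalRing

namespace Literature.AlgebraicGeometry.Resolution

universe u

/-- **A henselian valued field of residue characteristic `0` is a defectless field, from the
Lemma of Ostrowski** (Kuhlmann 2010, §2.3: (9) with `p = 1`, "Note that `(L|K,v)` is always
defectless if `char Kv = 0`", and §1: "`g = 1` if `(K,v)` is henselian"): for `L|K` finite the
valuation ring of `L` over `K°` exists (Chevalley) and is unique (henselian), and
`[L : K] = e·f·1^ν`. PROVED from `Kuhlmann2010OstrowskiLemma`. [cite: Kuhlmann2010, Section 2.3, (9) and Cor. 2.12] -/
theorem isDefectlessField_of_isHenselianField_of_ostrowski (hO : Kuhlmann2010OstrowskiLemma.{u})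
    (K : Type u) [Field K] (O : ValuationSubring K) (hK : IsHenselianField K O)
    [CharZero (ResidueField O)] : IsDefectlessField K O := by
  classical
  intro L _ _ hfin
  haveI := hfin
  haveI : Algebra.IsAlgebraic K L := Algebra.IsAlgebraic.of_finite K L
  -- an extension `O'` of `O` to `L` (Chevalley), unique since `K` is henselian
  obtain ⟨O', hO'⟩ := exists_valuationSubring_comap_eq (Ω := L) O
  have huniq : ∀ O'' : ValuationSubring L,
      O''.comap (algebraMap K L) = O'.comap (algebraMap K L) → O'' = O' := fun O'' h =>
    hK.eq_of_comap_eq (h.trans hO') hO'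
  -- Ostrowski with `p = 1`
  obtain ⟨ν, hν⟩ := hO K L inferInstance O' huniq
  haveI : CharZero (ResidueField (O'.comap (algebraMap K L))) := by
    rw [hO']
    infer_instance
  rw [ringExpChar.eq_one, one_pow, mul_one] at hν
  refine ⟨{O'}, fun O'' => ?_, by rw [Finset.sum_singleton, ← hν]⟩
  rw [Finset.mem_singleton]
  constructor
  · rintro rfl
    exact hO'
  · intro h
    exact huniq O'' (h.trans hO'.symm)

/-- **Kuhlmann 2010, Cor. 2.12 from the Lemma of Ostrowski** ("Therefore, Corollary 2.12. Every
valued field `(K,v)` with `char Kv = 0` is a defectless field"): PROVED from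
`Kuhlmann2010OstrowskiLemma`, through Thm. 2.14 (`Kuhlmann2010DefectlessIffHenselization_holds`):
extend `v` to `Ω = K̃` (Chevalley), identify `K` with its image `E ⊆ Ω` (`IsDefectlessField.congr`),
and apply the previous theorem to the henselian `E^h` (`Kuhlmann2010HenselizationIsHenselian_holds`),
whose residue field, like that of `V`, has characteristic `0` with `Kv` (the residue fields embed:
`residueFieldHom`). [cite: Kuhlmann2010, Cor. 2.12] -/
theorem Kuhlmann2010DefectlessOfResidueCharZero.of_ostrowski (hO : Kuhlmann2010OstrowskiLemma.{u}) :
    Kuhlmann2010DefectlessOfResidueCharZero.{u} := by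
  intro K _ O hchar
  haveI := hchar
  -- fix an extension `V` of `v` to the algebraic closure `Ω = K̃`
  obtain ⟨V, hV⟩ := exists_valuationSubring_comap_eq (Ω := AlgebraicClosure K) O
  subst hV
  haveI : CharZero (ResidueField V) :=
    (RingHom.charZero_iff (residueFieldHom K V).injective).mp hchar
  -- the image `E ⊆ Ω` of `K` and `ψ : K ≃ E`
  let ψ : K ≃+* (algebraMap K (AlgebraicClosure K)).fieldRange :=
    RingEquiv.ofBijective (algebraMap K (AlgebraicClosure K)).rangeRestrictField
      (algebraMap K (AlgebraicClosure K)).rangeRestrictField_bijective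
  have hOψ : V.comap (algebraMap K (AlgebraicClosure K)) =
      (V.comap (algebraMap (algebraMap K (AlgebraicClosure K)).fieldRange
        (AlgebraicClosure K))).comap ψ.toRingHom := by
    ext y
    simp only [ValuationSubring.mem_comap]
    exact Iff.rfl
  -- `E^h` is henselian of residue characteristic `0`, hence defectless (Ostrowski)
  have hEh : IsDefectlessField
      (henselization V (algebraMap K (AlgebraicClosure K)).fieldRange)
      (V.comap (algebraMap (henselization V (algebraMap K (AlgebraicClosure K)).fieldRange)
        (AlgebraicClosure K))) := by
    haveI : CharZero (ResidueField (V.comap (algebraMap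
        (henselization V (algebraMap K (AlgebraicClosure K)).fieldRange) (AlgebraicClosure K)))) :=
      (residueFieldHom _ V).charZero
    exact isDefectlessField_of_isHenselianField_of_ostrowski hO _ _
      (Kuhlmann2010HenselizationIsHenselian_holds _ V _)
  -- Thm. 2.14, and back to `K` along `ψ`
  have hE := (Kuhlmann2010DefectlessIffHenselization_holds (AlgebraicClosure K) V _).mpr hEh
  refine IsDefectlessField.congr ψ.symm ?_ hE
  rw [hOψ]
  exact (comap_comap_ringEquiv_symm ψ _).symm

end Literature.AlgebraicGeometry.Resolution
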